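import Literature.MathematicalPhysics.QuantumFieldTheory.Balaban1983to89.B9Thm312WholeLeafAll
import Literature.MathematicalPhysics.QuantumFieldTheory.Balaban1983to89.B9Thm312WholeHHolder

/-!
# `Balaban1983to89.B9Thm312WholeLeafComplete` — [B9] Theorem 3.12 (p. 423) AS THE WHOLE PRINTED LEAF `B9.Thm312Printed` AT THE PINS WITH NO
# DISPLAYED RESIDUAL: every member of the typed conclusion for G_D, G₁, H, H₁ is proved inside from operator-level schemas of printed shape,
# letters, relative co-readings and the member facts

T. Bałaban, *Propagators for lattice gauge theories in a background field*, Commun. Math. Phys. **99** (1985) 389–434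
[`Balaban1985BackgroundPropagators`, "B9"]; [4] = T. Bałaban, *Propagators and renormalization transformations for lattice
gauge theories. II*, Commun. Math. Phys. **96** (1984) 223–250 [`Balaban1984PropagatorsII`].

statement-level skeleton of published theorems with citation tags; proofs where landed; nothing here is a claim about the
Yang–Mills mass gap

THE PRINTED LOCI are those of `…B9Thm312WholeLeafCoGlob`, `…B9Thm312WholeClasses` and `…B9Thm312WholeHHolder` (verbatim there).

WHY THIS FILE (successor of `…B9Thm312WholeLeafAll.thm312Printed_of_stepAll`, same seat).  That leaf displays ONE residual line: the Hölder
member ‖ζ∇H(·,y′)‖_β of (3.133) for H, H₁.  Here it is PROVED INSIDE by `B9Thm312WholeHHolder.hkh_of_step` from the letter `LettersHH` (the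
Hölder probe of ∇_UG₀Q*, Theorem 3.3 (3.43)₁ for G₀ after Q*), the (3.132) letters of `LettersH`, the Hölder step `StepH.pY∕pY1`, the proved entry
of H (`B9Thm312WholeH.H_entry0`), the scale transfer of [4] (2.60) and the relative probe co-reading `CoReadsHHolderRel` of `HKernel.h` — and fed to
the landed leaf as its `hres` with the constant C(β) = (B_q(β)B₃c + θ_Ha₁·2B₃²c·c)·L_c², the rate δ₁ := 2(1 − α)ρ, the threshold max(M₁, M_L,
M_L′) and the smallness a₁′ := min(a₁, (2(θ₁c + 1))⁻¹).  RESULT: the typed leaf `B9.Thm312Printed d c35 geo bg GD G₁ Hk H₁k (HasRWExpOfOps)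
(HasRWExpHOfOps) (PosDefKOfOps)` with NO hypothesis about the Sect.-D propagators G_D, G₁, H, H₁ themselves: every input concerns G₀ (Theorem
3.3 in each class), Δ′_π ∕ Δ⁽²⁾_π (the step in each class), the letters Q, Q*, (QGQ*)⁻¹, (QG₁Q*)⁻¹, D, R, the probes and norms, the co-readings
of the kernel families, the identities of Sect. D and the member facts of [4] Lemma 2.1 (the pattern of n06-k's
`B9RWSums346Two.thm310Printed_allPin_complete` for rows 18–19).

WHAT THIS FILE PROVES (one theorem — 0 `def`, 0 named fact, 0 sorry): ★ `thm312Printed_complete`.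

HONEST SCOPE.  Nothing of print is asserted; every schema is a HYPOTHESIS of printed shape whose derivation (located gap G-B9-16) is not typed;
kernel-checked bookkeeping — NOT a node discharge, NOT summit progress; one finite lattice at a time; nothing continuum, nothing about the mass
gap.  Cell `pub-ymgap` (HUMAN RULING D-0062), Track A node N06 [B9], N06-ASSIGNMENT v1 row 20 (bundle F7), seat `pub-ymgap-dag-n06-l` (g4),
2026-08-27.
-/

namespace Literature.MathematicalPhysics.QuantumFieldTheory.Balaban1983to89.B9Thm312WholeLeafComplete

open Literature.MathematicalPhysics.QuantumFieldTheory.Balaban1983to89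
open Finset B6RandomWalk B6RandomWalkHom B9Thm34Ext B9Thm37Glue B9Thm37GlueCor36 B11SectG B9SectDSup B9SectDL2Decay
open B9Thm37AllNorms B9Thm37AllNormsInstances B9FromB6 B9FromB6ModelSignsOn B9SectBStepWhole B9Thm312Whole B9Thm312WholeLeaf
open B9Thm312WholeLeft B9Thm312WholeH B9Thm312WholeLeafLeftGlob B9Ineq347CoReading B9SectCDiffDict B9CoRealizesRel B9CoRealizesHRel
open B9RWSums343Holder B9RWSumsReadsRel B9Ineq347 B9Thm312WholeClasses B9Thm312WholeHolder B9Thm312WholeL2 B9Thm312WholeBlocksRel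
open B9Thm312WholeLeafAll B9Thm312WholeHHolder

noncomputable section

section Family

variable {I : Type} {d : ℕ} {c35 : ℝ} {geo : I → B9.Geometry} {bg : I → B9.Backgrounds}
variable [∀ i, Fintype (geo i).Site] [∀ i, DecidableEq (geo i).Site]
variable {X Y Z W PX PY : I → Type} [∀ i, Fintype (X i)] [∀ i, DecidableEq (X i)] [∀ i, Fintype (Y i)]
  [∀ i, Fintype (Z i)] [∀ i, Fintype (W i)] [∀ i, Fintype (PX i)] [∀ i, Fintype (PY i)]

omit [∀ i, Fintype (X i)] [∀ i, DecidableEq (X i)] [∀ i, Fintype (Y i)] [∀ i, Fintype (Z i)] [∀ i, Fintype (W i)]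
  [∀ i, Fintype (geo i).Site] [∀ i, DecidableEq (geo i).Site] [∀ i, Fintype (PX i)] [∀ i, Fintype (PY i)] in
/-- Arithmetic of *"for α₀ sufficiently small"*: t ≧ 0 and m ≦ (2(t + 1))⁻¹ give tm ≦ ½. [folklore] -/
private theorem small_aux₅ {t m : ℝ} (ht : 0 ≤ t) (hm : m ≤ (2 * (t + 1))⁻¹) : t * m ≤ 1 / 2 := by
  have hpos : 0 < 2 * (t + 1) := by linarith
  have h1 : t * m ≤ t * (2 * (t + 1))⁻¹ := mul_le_mul_of_nonneg_left hm ht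
  have h2 : t * (2 * (t + 1))⁻¹ ≤ 1 / 2 := by
    rw [← div_eq_mul_inv, div_le_iff₀ hpos]
    linarith
  linarith

/-- ★ **THEOREM 3.12 AS THE WHOLE PRINTED LEAF `B9.Thm312Printed`, AT THE PINS — NO DISPLAYED RESIDUAL** (p. 423).  Inputs: those of
`B9Thm312WholeLeafAll.thm312Printed_of_stepAll` WITHOUT `hres` (and without its constants B_β, δ₁), plus L_c ≧ 1, the letter `hLHH : LettersHH …`
(the Hölder probe of ∇_UG₀Q* with constants B_q(β) ≧ 0, rate δ₃) and the relative probe co-readings `hHC : CoReadsHHolderRel …` of the Hölder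
quantities of `Hk i`, `H₁k i` by ∇_UH, ∇_UH₁.  PROVED INSIDE: every member — (3.42)₁,₂,₃, (3.46)₀₋₅, (3.43)–(3.45), (3.47)₀,₁,₂ for G_D, G₁; all
three members of (3.133) for H, H₁; Theorem 3.11; the pins.  Route: `thm312Printed_of_stepAll` with the threshold max(M₁, M_L, M_L′), the
smallness min(a₁, (2(θ₁c + 1))⁻¹) and `hres` supplied by `B9Thm312WholeHHolder.hkh_of_step` at the uniform constant (B_q(β)B₃c +
θ_Ha₁(2B₃²c)c)L_c² and the rate 2(1 − α)ρ.  Nothing of print asserted; NOT a node discharge.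
[cite: Balaban1985BackgroundPropagators, Thm 3.12 pp.421–423 + (3.41)–(3.47) pp.397–398 + (3.126) p.420 + (3.129) p.421 + (3.132)–(3.133) p.422; Balaban1984PropagatorsII, (2.51)–(2.52) p.232 + Lemma 2.1 (2.60)–(2.61) p.234] -/
theorem thm312Printed_complete (𝔬 : ∀ i, Ops (geo i) (bg i) (X i) (Y i) (Z i) (W i)) (R₀ : I → ℝ) (H₀ : I → Prop)
    (𝔭 : ∀ i, HolderProbes (geo i) (bg i) (X i) (Y i) (PX i) (PY i))
    (bH : ∀ i, ℝ → BlockNorm (toB6 (geo i) (R₀ i) (H₀ i)) (Y i → ℝ)) (Lap : ∀ i, (bg i).Cfg → Module.End ℝ (X i → ℝ))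
    (GD G₁ : ∀ i, B9.KernelFamily (geo i) (bg i)) (Hk H₁k : ∀ i, B9.HKernel (geo i) (bg i))
    (ev : ∀ i, (geo i).Loc → X i → ℝ) (evY : ∀ i, (geo i).Loc → Y i → ℝ) {P : ∀ i, (geo i).Loc → Prop}
    (Rel : ∀ i, (geo i).Site → (geo i).Site → Prop) [∀ i, DecidableRel (Rel i)] (m : ℕ)
    (θ₁ θD θH θ₂ r₁ B₀ B₂ δ₀ δK σ c ρ ρf a₁ M₁ ML B₃ δ₃ α Lc : ℝ) (Bh Bi Bq : ℝ → ℝ) (Bi2 : ℝ → ℝ → ℝ)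
    (hθ₁ : 0 ≤ θ₁) (hθD : 0 ≤ θD) (hθH : 0 ≤ θH) (hθ₂ : 0 ≤ θ₂) (hr₁ : 0 ≤ r₁) (hB₀ : 0 ≤ B₀) (hB₂ : 0 ≤ B₂) (hB₃ : 0 ≤ B₃)
    (hσ : 0 ≤ σ) (hρ : 0 < ρ) (hρS : ρ ≤ δ₀) (hρδ : ρ + σ ≤ δK) (hρ₃ : ρ + σ ≤ δ₃) (hc : 0 ≤ c) (ha₁ : 0 < a₁) (hM₁ : 0 < M₁)
    (hα : α ≤ 1 / 2) (hα0 : 0 ≤ α) (hρf : 0 < ρf) (hρf1 : ρf + σ ≤ (1 - α) * ρ) (hρf2 : ρf + 2 * σ + α * ρ ≤ ρ)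
    (hBh : ∀ β, 0 ≤ β → β < 1 → 0 ≤ Bh β) (hBi : ∀ ε, 0 < ε → ε ≤ 1 → 0 ≤ Bi ε)
    (hBi2 : ∀ ε β, 0 < ε → ε ≤ 1 → 0 ≤ β → β < 1 → 0 ≤ Bi2 ε β) (hBq : ∀ β, 0 ≤ Bq β)
    (hgeo : ∀ i, GeoOK (geo i)) (S : ∀ i, ModelSignsOn (geo i) (P i))
    (hL1 : ∀ i, 1 ≤ (geo i).L) (hLle : ∀ i, (geo i).L ≤ Lc) (hLc : 1 ≤ Lc) (hη : ∀ i, 0 < (geo i).eta)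
    (hrow : ∀ i, ML ≤ (geo i).M → RowSum (toB6 (geo i) (R₀ i) (H₀ i)) σ c)
    (hL21 : ∀ δ : ℝ, 0 < δ → ∃ ML' c' : ℝ, Lemma21AboveG geo R₀ H₀ δ α ML' c')
    (hsat : ∀ (i : I) (n : Fin 4) (B' δ' : ℝ),
      (∀ a a' b, Rel i a a' → maj342 (geo i) n B' δ' a b = maj342 (geo i) n B' δ' a' b) ∧
      (∀ a b b', Rel i b b' → maj342 (geo i) n B' δ' a b = maj342 (geo i) n B' δ' a b'))
    (hmult : ∀ (i : I) (y' : (geo i).Site), (Finset.univ.filter (fun y'' => Rel i y'' y')).card ≤ m)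
    (hRdist : ∀ (i : I) (a a' b : (geo i).Site), Rel i a a' → (geo i).dist a b = (geo i).dist a' b)
    (hRdist' : ∀ (i : I) (a b b' : (geo i).Site), Rel i b b' → (geo i).dist a b = (geo i).dist a b')
    (hRlen : ∀ (i : I) (a a' : (geo i).Site), Rel i a a' → (geo i).len a = (geo i).len a')
    (hcoR : ∀ (i : I) (U : (bg i).Cfg),
      CoRealizesRel (GD i) 0 U (Rel i) (𝔬 i).blk (𝔬 i).blk (ev i) ((𝔬 i).G U) ∧
      CoRealizesRel (GD i) 2 U (Rel i) (𝔬 i).blk (𝔬 i).blkY (evY i) ((𝔬 i).G U ∘ₗ (𝔬 i).Dstar U) ∧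
      CoRealizesRel (G₁ i) 0 U (Rel i) (𝔬 i).blk (𝔬 i).blk (ev i) ((𝔬 i).G1 U) ∧
      CoRealizesRel (G₁ i) 2 U (Rel i) (𝔬 i).blk (𝔬 i).blkY (evY i) ((𝔬 i).G1 U ∘ₗ (𝔬 i).Dstar U))
    (hco1R : ∀ (i : I) (U : (bg i).Cfg),
      CoRealizesRel (GD i) 1 U (Rel i) (𝔬 i).blkY (𝔬 i).blk (ev i) ((𝔬 i).D U ∘ₗ (𝔬 i).G U) ∧
      CoRealizesRel (G₁ i) 1 U (Rel i) (𝔬 i).blkY (𝔬 i).blk (ev i) ((𝔬 i).D U ∘ₗ (𝔬 i).G1 U))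
    (hcoHR : ∀ (i : I) (U : (bg i).Cfg),
      CoRealizesHRel (Hk i) 0 U d (Rel i) (𝔬 i).blk (𝔬 i).blkZ ((𝔬 i).Hm U) ∧
      CoRealizesHRel (Hk i) 1 U d (Rel i) (𝔬 i).blkY (𝔬 i).blkZ ((𝔬 i).D U ∘ₗ (𝔬 i).Hm U) ∧
      CoRealizesHRel (H₁k i) 0 U d (Rel i) (𝔬 i).blk (𝔬 i).blkZ ((𝔬 i).H1m U) ∧
      CoRealizesHRel (H₁k i) 1 U d (Rel i) (𝔬 i).blkY (𝔬 i).blkZ ((𝔬 i).D U ∘ₗ (𝔬 i).H1m U))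
    (hcoG : ∀ (i : I) (U : (bg i).Cfg),
      CoReadsGlob (GD i) 0 U (𝔬 i).blk (𝔬 i).blk (ev i) ((𝔬 i).G U) ∧
      CoReadsGlob (GD i) 1 U (𝔬 i).blkY (𝔬 i).blk (ev i) ((𝔬 i).D U ∘ₗ (𝔬 i).G U) ∧
      CoReadsGlob (GD i) 2 U (𝔬 i).blk (𝔬 i).blkY (evY i) ((𝔬 i).G U ∘ₗ (𝔬 i).Dstar U) ∧
      CoReadsGlob (G₁ i) 0 U (𝔬 i).blk (𝔬 i).blk (ev i) ((𝔬 i).G1 U) ∧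
      CoReadsGlob (G₁ i) 1 U (𝔬 i).blkY (𝔬 i).blk (ev i) ((𝔬 i).D U ∘ₗ (𝔬 i).G1 U) ∧
      CoReadsGlob (G₁ i) 2 U (𝔬 i).blk (𝔬 i).blkY (evY i) ((𝔬 i).G1 U ∘ₗ (𝔬 i).Dstar U))
    (hl2R : ∀ (i : I) (U : (bg i).Cfg),
      (L2ReadsRel (R := R₀ i) (H := H₀ i) (GD i) 0 U (Rel i) (𝔬 i).blk (𝔬 i).blk (ev i) ((𝔬 i).G U) ∧
        L2ReadsRel (R := R₀ i) (H := H₀ i) (GD i) 1 U (Rel i) (𝔬 i).blkY (𝔬 i).blk (ev i) ((𝔬 i).D U ∘ₗ (𝔬 i).G U) ∧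
        L2ReadsRel (R := R₀ i) (H := H₀ i) (GD i) 2 U (Rel i) (𝔬 i).blk (𝔬 i).blkY (evY i) ((𝔬 i).G U ∘ₗ (𝔬 i).Dstar U) ∧
        L2ReadsRel (R := R₀ i) (H := H₀ i) (GD i) 3 U (Rel i) (𝔬 i).blk (𝔬 i).blk (ev i) (Lap i U ∘ₗ (𝔬 i).G U) ∧
        L2ReadsRel (R := R₀ i) (H := H₀ i) (GD i) 4 U (Rel i) (𝔬 i).blkY (𝔬 i).blkY (evY i)
          ((𝔬 i).D U ∘ₗ ((𝔬 i).G U ∘ₗ (𝔬 i).Dstar U)) ∧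
        L2ReadsRel (R := R₀ i) (H := H₀ i) (GD i) 5 U (Rel i) (𝔬 i).blk (𝔬 i).blk (ev i) ((𝔬 i).G U ∘ₗ Lap i U)) ∧
      (L2ReadsRel (R := R₀ i) (H := H₀ i) (G₁ i) 0 U (Rel i) (𝔬 i).blk (𝔬 i).blk (ev i) ((𝔬 i).G1 U) ∧
        L2ReadsRel (R := R₀ i) (H := H₀ i) (G₁ i) 1 U (Rel i) (𝔬 i).blkY (𝔬 i).blk (ev i) ((𝔬 i).D U ∘ₗ (𝔬 i).G1 U) ∧
        L2ReadsRel (R := R₀ i) (H := H₀ i) (G₁ i) 2 U (Rel i) (𝔬 i).blk (𝔬 i).blkY (evY i) ((𝔬 i).G1 U ∘ₗ (𝔬 i).Dstar U) ∧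
        L2ReadsRel (R := R₀ i) (H := H₀ i) (G₁ i) 3 U (Rel i) (𝔬 i).blk (𝔬 i).blk (ev i) (Lap i U ∘ₗ (𝔬 i).G1 U) ∧
        L2ReadsRel (R := R₀ i) (H := H₀ i) (G₁ i) 4 U (Rel i) (𝔬 i).blkY (𝔬 i).blkY (evY i)
          ((𝔬 i).D U ∘ₗ ((𝔬 i).G1 U ∘ₗ (𝔬 i).Dstar U)) ∧
        L2ReadsRel (R := R₀ i) (H := H₀ i) (G₁ i) 5 U (Rel i) (𝔬 i).blk (𝔬 i).blk (ev i) ((𝔬 i).G1 U ∘ₗ Lap i U)))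
    (hH1R : ∀ (i : I) (U : (bg i).Cfg),
      H1ReadsRel (GD i) U (𝔭 i) (Rel i) (𝔬 i).blk (𝔬 i).blkY (ev i) (evY i) ((𝔬 i).D U ∘ₗ (𝔬 i).G U)
        ((𝔬 i).G U ∘ₗ (𝔬 i).Dstar U) ∧
      H1ReadsRel (G₁ i) U (𝔭 i) (Rel i) (𝔬 i).blk (𝔬 i).blkY (ev i) (evY i) ((𝔬 i).D U ∘ₗ (𝔬 i).G1 U)
        ((𝔬 i).G1 U ∘ₗ (𝔬 i).Dstar U))
    (hIR : ∀ (i : I) (U : (bg i).Cfg),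
      InputReadsRel (GD i) U (𝔭 i) (bH i) (Rel i) (𝔬 i).blkY (evY i) ((𝔬 i).D U ∘ₗ ((𝔬 i).G U ∘ₗ (𝔬 i).Dstar U)) ∧
      InputReadsRel (G₁ i) U (𝔭 i) (bH i) (Rel i) (𝔬 i).blkY (evY i) ((𝔬 i).D U ∘ₗ ((𝔬 i).G1 U ∘ₗ (𝔬 i).Dstar U)))
    (hsym : ∀ (i : I) (U : (bg i).Cfg), IsTransposePair ((𝔬 i).G U) ((𝔬 i).G U) ∧ IsTransposePair ((𝔬 i).G1 U) ((𝔬 i).G1 U))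
    (htr : ∀ (i : I) (U : (bg i).Cfg),
      IsTransposePair ((𝔬 i).D U ∘ₗ (𝔬 i).G U) ((𝔬 i).G U ∘ₗ (𝔬 i).Dstar U) ∧
      IsTransposePair ((𝔬 i).D U ∘ₗ (𝔬 i).G1 U) ((𝔬 i).G1 U ∘ₗ (𝔬 i).Dstar U))
    (hmodel : ∀ i, M₁ ≤ (geo i).M → ∀ α₀ : ℝ, 0 < α₀ → (geo i).M * α₀ ≤ a₁ →
      ∀ U : (bg i).Cfg, (bg i).Reg335 c35 α₀ U → (bg i).Reg336 c35 α₀ U →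
        Thm33G0 (𝔬 i) (R₀ i) (H₀ i) B₀ δ₀ U ∧
        Step (𝔬 i) (R₀ i) (H₀ i) (hgeo i).lenle 1 (θ₁ * ((geo i).M * α₀)) δK U ∧
        Step (𝔬 i) (R₀ i) (H₀ i) (hgeo i).lenle 2 (θ₁ * ((geo i).M * α₀)) δK U ∧
        FormSmall (𝔬 i) (r₁ * ((geo i).M * α₀)) U ∧ Identities (𝔬 i) U)
    (hleft : ∀ i, M₁ ≤ (geo i).M → ∀ α₀ : ℝ, 0 < α₀ → (geo i).M * α₀ ≤ a₁ →
      ∀ U : (bg i).Cfg, (bg i).Reg335 c35 α₀ U → (bg i).Reg336 c35 α₀ U →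
        LeftStep (𝔬 i) (R₀ i) (H₀ i) (hgeo i).lenle B₀ δ₀ (θD * ((geo i).M * α₀)) δK U)
    (hlettersH : ∀ i, M₁ ≤ (geo i).M → ∀ α₀ : ℝ, 0 < α₀ → (geo i).M * α₀ ≤ a₁ →
      ∀ U : (bg i).Cfg, (bg i).Reg335 c35 α₀ U → (bg i).Reg336 c35 α₀ U →
        LettersH (𝔬 i) (R₀ i) (H₀ i) (hgeo i) B₃ δ₃ U)
    (hG0C : ∀ i, M₁ ≤ (geo i).M → ∀ α₀ : ℝ, 0 < α₀ → (geo i).M * α₀ ≤ a₁ →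
      ∀ U : (bg i).Cfg, (bg i).Reg335 c35 α₀ U → (bg i).Reg336 c35 α₀ U →
        Thm33G0H (𝔬 i) (𝔭 i) (R₀ i) (H₀ i) (bH i) Bh Bi Bi2 δ₀ U ∧ Thm33G0L2 (𝔬 i) (Lap i) (R₀ i) (H₀ i) B₂ δ₀ U)
    (hstepC : ∀ i, M₁ ≤ (geo i).M → ∀ α₀ : ℝ, 0 < α₀ → (geo i).M * α₀ ≤ a₁ →
      ∀ U : (bg i).Cfg, (bg i).Reg335 c35 α₀ U → (bg i).Reg336 c35 α₀ U →
        StepH (𝔬 i) (𝔭 i) (R₀ i) (H₀ i) (bH i) (hgeo i).lenle (θH * ((geo i).M * α₀)) δK U ∧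
        StepL2 (𝔬 i) (R₀ i) (H₀ i) (θ₂ * ((geo i).M * α₀)) δK U)
    (hLHH : ∀ i, M₁ ≤ (geo i).M → ∀ α₀ : ℝ, 0 < α₀ → (geo i).M * α₀ ≤ a₁ →
      ∀ U : (bg i).Cfg, (bg i).Reg335 c35 α₀ U → (bg i).Reg336 c35 α₀ U →
        LettersHH (𝔬 i) (𝔭 i) (R₀ i) (H₀ i) (hgeo i).lenle Bq δ₃ U)
    (hHC : ∀ (i : I) (U : (bg i).Cfg),
      CoReadsHHolderRel (Hk i) U d (Rel i) (𝔭 i) (𝔬 i).blkZ ((𝔬 i).D U ∘ₗ (𝔬 i).Hm U) ∧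
      CoReadsHHolderRel (H₁k i) U d (Rel i) (𝔭 i) (𝔬 i).blkZ ((𝔬 i).D U ∘ₗ (𝔬 i).H1m U)) :
    B9.Thm312Printed d c35 geo bg GD G₁ Hk H₁k (fun i => HasRWExpOfOps (𝔬 i)) (fun i => HasRWExpHOfOps (𝔬 i))
      (fun i => PosDefKOfOps (𝔬 i)) := by
  -- thresholds and constants
  obtain ⟨MLg, cg, hLg⟩ := hL21 ρ hρ
  set M₁' : ℝ := max (max M₁ ML) MLg with hM₁'
  have hM₁'pos : 0 < M₁' := lt_max_of_lt_left (lt_max_of_lt_left hM₁)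
  have hle₁ : ∀ {i : I}, M₁' ≤ (geo i).M → M₁ ≤ (geo i).M := fun h => ((le_max_left _ _).trans (le_max_left _ _)).trans h
  have hleL : ∀ {i : I}, M₁' ≤ (geo i).M → ML ≤ (geo i).M := fun h => ((le_max_right _ _).trans (le_max_left _ _)).trans h
  have hleg : ∀ {i : I}, M₁' ≤ (geo i).M → MLg ≤ (geo i).M := fun h => (le_max_right _ _).trans h
  have hθc : 0 ≤ θ₁ * c := mul_nonneg hθ₁ hc
  set a₁' : ℝ := min a₁ (2 * (θ₁ * c + 1))⁻¹ with ha₁'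
  have ha₁'pos : 0 < a₁' := lt_min ha₁ (inv_pos.mpr (by linarith))
  have ha₁'le : a₁' ≤ a₁ := min_le_left _ _
  have h1α : 0 < 1 - α := by linarith
  have hδ₁ : 0 < 2 * ((1 - α) * ρ) := by positivity
  have hB33 : 0 ≤ B₃ * B₃ * c := mul_nonneg (mul_nonneg hB₃ hB₃) hc
  have hLc0 : 0 ≤ Lc := zero_le_one.trans hLc
  have hLc2 : 0 ≤ Lc ^ (2 : ℝ) := Real.rpow_nonneg hLc0 _
  have htHa : 0 ≤ θH * a₁ := mul_nonneg hθH ha₁.le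
  set BβH : ℝ → ℝ := fun β => (Bq β * B₃ * c + θH * a₁ * (2 * (B₃ * B₃ * c)) * c) * Lc ^ (2 : ℝ) with hBβH
  have hBβH0 : ∀ β, 0 ≤ BβH β := fun β =>
    mul_nonneg (add_nonneg (mul_nonneg (mul_nonneg (hBq β) hB₃) hc) (mul_nonneg (mul_nonneg htHa (by linarith)) hc)) hLc2
  refine thm312Printed_of_stepAll 𝔬 R₀ H₀ 𝔭 bH Lap GD G₁ Hk H₁k ev evY Rel m θ₁ θD θH θ₂ r₁ B₀ B₂ δ₀ δK σ c ρ ρf a₁' M₁' ML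
    (2 * ((1 - α) * ρ)) B₃ δ₃ α Lc Bh Bi BβH Bi2 hθ₁ hθD hθH hθ₂ hr₁ hB₀ hB₂ hB₃ hσ hρ hρS hρδ hρ₃ hc ha₁'pos hM₁'pos hδ₁ hα hα0 hρf
    hρf1 hρf2 hBh hBi hBi2 hBβH0 hgeo S hL1 hLle hη hrow hL21 hsat hmult hRdist hRdist' hRlen hcoR hco1R hcoHR hcoG hl2R hH1R hIR hsym
    htr (fun i hM α₀ hα₀ hMa U hU hU' => hmodel i (hle₁ hM) α₀ hα₀ (hMa.trans ha₁'le) U hU hU')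
    (fun i hM α₀ hα₀ hMa U hU hU' => hleft i (hle₁ hM) α₀ hα₀ (hMa.trans ha₁'le) U hU hU')
    (fun i hM α₀ hα₀ hMa U hU hU' => hlettersH i (hle₁ hM) α₀ hα₀ (hMa.trans ha₁'le) U hU hU')
    (fun i hM α₀ hα₀ hMa U hU hU' => hG0C i (hle₁ hM) α₀ hα₀ (hMa.trans ha₁'le) U hU hU')
    (fun i hM α₀ hα₀ hMa U hU hU' => hstepC i (hle₁ hM) α₀ hα₀ (hMa.trans ha₁'le) U hU hU') ?_
  -- the (3.133)-Hölder member of H, H₁, proved per member and per configuration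
  intro i hM α₀ hα₀ hMa U hU hU' Hk' hK β ζ y y' h0 h1 hζ
  have hM₁i : M₁ ≤ (geo i).M := hle₁ hM
  have hMpos : 0 < (geo i).M := hM₁.trans_le hM₁i
  have hm0 : 0 ≤ (geo i).M * α₀ := (mul_pos hMpos hα₀).le
  have hma₁ : (geo i).M * α₀ ≤ a₁ := hMa.trans ha₁'le
  have hmθ : (geo i).M * α₀ ≤ (2 * (θ₁ * c + 1))⁻¹ := hMa.trans (min_le_right _ _)
  obtain ⟨h33, hS1, hS2, hF, hI⟩ := hmodel i hM₁i α₀ hα₀ hma₁ U hU hU'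
  have hLH := hlettersH i hM₁i α₀ hα₀ hma₁ U hU hU'
  obtain ⟨hStH, -⟩ := hstepC i hM₁i α₀ hα₀ hma₁ U hU hU'
  have hHH := hLHH i hM₁i α₀ hα₀ hma₁ U hU hU'
  have hrowi := hrow i (hleL hM)
  obtain ⟨h260, -, hsize⟩ := hLg i (hleg hM)
  obtain ⟨hHC0, hHC1⟩ := hHC i U
  set θ : ℝ := θ₁ * ((geo i).M * α₀) with hθdef
  set θH' : ℝ := θH * ((geo i).M * α₀) with hθH'def
  have hθ : 0 ≤ θ := mul_nonneg hθ₁ hm0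
  have hθH' : 0 ≤ θH' := mul_nonneg hθH hm0
  have hθH'le : θH' ≤ θH * a₁ := mul_le_mul_of_nonneg_left hma₁ hθH
  have hq : θ * c ≤ 1 / 2 := by
    have h := small_aux₅ hθc hmθ
    calc θ * c = θ₁ * c * ((geo i).M * α₀) := by rw [hθdef]; ring
      _ ≤ 1 / 2 := h
  have hq1 : θ * c < 1 := lt_one_of_le_half hq
  have hinv0 : 0 ≤ (1 - θ * c)⁻¹ := inv_nonneg.mpr (sub_nonneg.mpr hq1.le)
  have hinv2 : (1 - θ * c)⁻¹ ≤ 2 := inv_one_sub_le_two hq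
  have hfix := fix_of_inverses hI.invG0' hI.invG
  have hfix1 := fix_of_inverses hI.invG0' hI.invG1
  have hKH0 : 0 ≤ B₃ * B₃ * c * (1 - θ * c)⁻¹ := mul_nonneg hB33 hinv0
  -- the scale transfer of the class ratio (Lʲη∕L^{j′}η)² at (ρ, α), constant L_c²
  have hL0i : 0 < (geo i).L := lt_of_lt_of_le one_pos (hL1 i)
  have hST2 : ScaleTransfer (geo i) ρ α (Lc ^ (2 : ℝ)) (fun y => (geo i).len y ^ (2 : ℝ)) := by
    have h2 := scaleTransfer_rpow_of_260 h260 hsize (hL1 i) (hη i) 2 (by norm_num)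
    have hΛle : (geo i).L ^ |(2 : ℝ)| ≤ Lc ^ (2 : ℝ) := by
      rw [abs_of_pos (by norm_num : (0 : ℝ) < 2)]
      exact Real.rpow_le_rpow hL0i.le (hLle i) (by norm_num)
    exact fun y y' => (h2 y y').trans (mul_le_mul_of_nonneg_right hΛle (B9Ineq347AllEntries.weight_nonneg (geo i) hL0i (hη i) 2 y))
  -- the entries H, H₁ : 𝔠_Z^{(−2)} → 𝔠^{(−2)} (proved upstream)
  have hH0m : HasMaj (cNorm (R₀ i) (H₀ i) (𝔬 i).blkZ (hgeo i).lenle 2) (cNorm (R₀ i) (H₀ i) (𝔬 i).blk (hgeo i).lenle 2) ((𝔬 i).Hm U)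
      (fun a b => B₃ * B₃ * c * (1 - θ * c)⁻¹ * Real.exp (-(ρ * (geo i).dist a b))) := by
    rw [hI.eq126]
    exact H_entry0 (hgeo i) hrowi hc hθ hB₃ hσ hρ.le hρ₃ hρδ hS2.step hLH.gQs2 hLH.c2 hfix hq1
  have hH10m : HasMaj (cNorm (R₀ i) (H₀ i) (𝔬 i).blkZ (hgeo i).lenle 2) (cNorm (R₀ i) (H₀ i) (𝔬 i).blk (hgeo i).lenle 2) ((𝔬 i).H1m U)
      (fun a b => B₃ * B₃ * c * (1 - θ * c)⁻¹ * Real.exp (-(ρ * (geo i).dist a b))) := by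
    rw [hI.eq129]
    exact H_entry0 (hgeo i) hrowi hc hθ hB₃ hσ hρ.le hρ₃ hρδ hS2.step1 hLH.gQs2 hLH.c12 hfix1 hq1
  -- the uniform constant dominates the member constant
  have hCle : (Bq β * B₃ * c + θH' * (B₃ * B₃ * c * (1 - θ * c)⁻¹) * c) * Lc ^ (2 : ℝ) ≤ BβH β := by
    have h1 : B₃ * B₃ * c * (1 - θ * c)⁻¹ ≤ 2 * (B₃ * B₃ * c) := by
      have := mul_le_mul_of_nonneg_left hinv2 hB33; linarith
    have h2 : θH' * (B₃ * B₃ * c * (1 - θ * c)⁻¹) * c ≤ θH * a₁ * (2 * (B₃ * B₃ * c)) * c :=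
      mul_le_mul_of_nonneg_right (mul_le_mul hθH'le h1 hKH0 htHa) hc
    exact mul_le_mul_of_nonneg_right (by linarith) hLc2
  have hrate : 2 * ((1 - α) * ρ) / 2 = (1 - α) * ρ := by ring
  rw [hrate]
  have hmain : ∀ {Hk'' : B9.HKernel (geo i) (bg i)},
      (∀ (ζ : (geo i).Cut) (y y' : (geo i).Site), (geo i).cutInT ζ y →
        Hk''.h U β ζ y' ≤ ((Bq β * B₃ * c + θH' * (B₃ * B₃ * c * (1 - θ * c)⁻¹) * c) * Lc ^ (2 : ℝ)) * (geo i).cutH β ζ *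
          ((geo i).len y) ^ (-(1 + β)) * ((geo i).len y') ^ (-(d : ℝ)) * Real.exp (-((1 - α) * ρ * (geo i).dist y y'))) →
      Hk''.h U β ζ y' ≤ BβH β * (geo i).cutH β ζ * ((geo i).len y) ^ (-(1 + β)) * ((geo i).len y') ^ (-(d : ℝ)) *
        Real.exp (-((1 - α) * ρ * (geo i).dist y y')) := by
    intro Hk'' h
    refine (h ζ y y' hζ).trans ?_
    have hnn : 0 ≤ (geo i).cutH β ζ * ((geo i).len y) ^ (-(1 + β)) * ((geo i).len y') ^ (-(d : ℝ)) *
        Real.exp (-((1 - α) * ρ * (geo i).dist y y')) :=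
      mul_nonneg (mul_nonneg (mul_nonneg ((S i).cutH_nonneg β ζ) (Real.rpow_nonneg ((hgeo i).lenle y) _))
        (Real.rpow_nonneg ((hgeo i).lenle y') _)) (Real.exp_nonneg _)
    have hm := mul_le_mul_of_nonneg_right hCle hnn
    calc (Bq β * B₃ * c + θH' * (B₃ * B₃ * c * (1 - θ * c)⁻¹) * c) * Lc ^ (2 : ℝ) * (geo i).cutH β ζ *
          ((geo i).len y) ^ (-(1 + β)) * ((geo i).len y') ^ (-(d : ℝ)) * Real.exp (-((1 - α) * ρ * (geo i).dist y y'))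
        = (Bq β * B₃ * c + θH' * (B₃ * B₃ * c * (1 - θ * c)⁻¹) * c) * Lc ^ (2 : ℝ) * ((geo i).cutH β ζ *
            ((geo i).len y) ^ (-(1 + β)) * ((geo i).len y') ^ (-(d : ℝ)) * Real.exp (-((1 - α) * ρ * (geo i).dist y y'))) := by ring
      _ ≤ BβH β * ((geo i).cutH β ζ * ((geo i).len y) ^ (-(1 + β)) * ((geo i).len y') ^ (-(d : ℝ)) *
            Real.exp (-((1 - α) * ρ * (geo i).dist y y'))) := hm
      _ = BβH β * (geo i).cutH β ζ * ((geo i).len y) ^ (-(1 + β)) * ((geo i).len y') ^ (-(d : ℝ)) *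
            Real.exp (-((1 - α) * ρ * (geo i).dist y y')) := by ring
  have hK2 : Hk' = Hk i ∨ Hk' = H₁k i := by simpa using hK
  rcases hK2 with rfl | rfl
  · exact hmain (hkh_of_step (hgeo i) (𝔭 i) hrowi hθH' (hBq β) hB₃ hKH0 hLc2 hσ hρ.le hρ₃ hρδ hHC0 (hRdist i) (hRlen i) hST2
      (hHH.pQ β h0 h1) hLH.c2 (hStH.pY β h0 h1) hH0m hI.eq126 hfix)
  · exact hmain (hkh_of_step (hgeo i) (𝔭 i) hrowi hθH' (hBq β) hB₃ hKH0 hLc2 hσ hρ.le hρ₃ hρδ hHC1 (hRdist i) (hRlen i) hST2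
      (hHH.pQ β h0 h1) hLH.c12 (hStH.pY1 β h0 h1) hH10m hI.eq129 hfix1)

end Family

end

end Literature.MathematicalPhysics.QuantumFieldTheory.Balaban1983to89.B9Thm312WholeLeafComplete
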